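import Literature.MathematicalPhysics.QuantumFieldTheory.QCDHeavyQuarkPropagator

/-!
# WORKFILE (crux stmt-QuantumFields-11512): phase-quenched toolkit lemmas prepared by the lead

Two architecture-agnostic steps every fractional-moment line of this crux (and of `MobilityGap`)
needs, written as APPENDS to existing Literature files (proposals pending on a saturated gate; exact
commands in the lead folder `work/lit/PROPOSE.md`, items F and G):

* `qcdPhaseQuenchedExpect_rpow_le_rpow` (append to `QCDPhaseQuenchedReweighting.lean`): Lyapunov /
  Jensen exponent lowering `⟨Y^{s′}⟩₊ ≤ ⟨Y^s⟩₊^{s′/s}` for `0 < s′ ≤ s`;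
* `norm_det_diracMatrix_smul_sameFlavourBlock`, `norm_det_diracMatrix_mul_apply_inv_eq` (append to
  `QCDHeavyQuarkPropagator.lean`): under the weight `|det diracMatrix|` the same-flavour block of the
  `N_f`-flavour propagator may be replaced by the one-flavour propagator, with no invertibility
  hypothesis.
Here they are stated in the crux namespace so that the file elaborates stand-alone (rc 0).
-/

noncomputable section

open MeasureTheory Filter
open Literature.MathematicalPhysics.QuantumLattice Literature.Probability.LatticeModels
open Literature.MathematicalPhysics.QuantumFieldTheory

namespace Summit.QuantumFields.QCD.Cruxes.FMClosureUnquenched.Toolkit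

variable {Nf : ℕ} {S : ℕ} [NeZero S]

/-- **Lowering the exponent of a phase-quenched moment (Lyapunov / Jensen)**: for a non-negative
observable `Y` and `0 < s′ ≤ s`, `⟨Y^{s′}⟩₊ ≤ ⟨Y^s⟩₊^{s′/s}` — `t ↦ t^{s/s′}` is convex on `[0, ∞)`
and `⟨·⟩₊` is integration against the probability measure `qcdLatticeMeasure`
(`qcdPhaseQuenchedExpect_jensen`).  This is the step "lower the input's exponent to the one the
fibre bounds allow" of every fractional-moment bootstrap for the lattice quark propagator
(Aizenman–Schenker–Friedrich–Hundertmark 2001, proof of Thm 2). [folklore] -/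
theorem qcdPhaseQuenchedExpect_rpow_le_rpow (β : ℝ) (mq : Fin Nf → ℝ)
    (h : 0 < ∫ U, ‖(diracMatrix U mq).det‖ ∂(wilsonMeasure (d := 4) (L := S) (fundamentalRep (Fin 3)) β))
    (Y : GaugeConfig 4 S SU3 → ℝ) (hY0 : ∀ U, 0 ≤ Y U) {s' s : ℝ} (hs' : 0 < s') (hss : s' ≤ s)
    (hi' : Integrable (fun U => Y U ^ s') (qcdLatticeMeasure S β mq))
    (hi : Integrable (fun U => Y U ^ s) (qcdLatticeMeasure S β mq)) :
    qcdPhaseQuenchedExpect β S mq (fun U => Y U ^ s') ≤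
      (qcdPhaseQuenchedExpect β S mq (fun U => Y U ^ s)) ^ (s' / s) := by
  have hs : 0 < s := hs'.trans_le hss
  set p : ℝ := s / s' with hp
  have hp1 : 1 ≤ p := by rw [hp, le_div_iff₀ hs']; linarith
  have hp0 : 0 < p := one_pos.trans_le hp1
  -- Jensen for the convex power `t ↦ t^p` on `[0, ∞)` applied to `φ = Y^{s'}`, `(Y^{s'})^p = Y^s`
  have hcomp : (fun t : ℝ => t ^ p) ∘ (fun U => Y U ^ s') = fun U => Y U ^ s := by
    funext U
    simp only [Function.comp_apply]
    rw [← Real.rpow_mul (hY0 U), hp, mul_div_cancel₀ _ hs'.ne']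
  have hJ := qcdPhaseQuenchedExpect_jensen (S := S) β mq h (convexOn_rpow hp1)
    (Real.continuous_rpow_const hp0.le).continuousOn
    isClosed_Ici (fun U => Y U ^ s') (Eventually.of_forall fun U => Real.rpow_nonneg (hY0 U) _)
    hi' (by rw [hcomp]; exact hi)
  rw [hcomp] at hJ
  -- undo the power: `a^p ≤ b`, `a, b ≥ 0` ⇒ `a ≤ b^{1/p} = b^{s'/s}`
  have ha : 0 ≤ qcdPhaseQuenchedExpect β S mq (fun U => Y U ^ s') := by
    rw [qcdPhaseQuenchedExpect_eq_integral_qcdLatticeMeasure]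
    exact integral_nonneg fun U => Real.rpow_nonneg (hY0 U) _
  have hb : 0 ≤ qcdPhaseQuenchedExpect β S mq (fun U => Y U ^ s) := by
    rw [qcdPhaseQuenchedExpect_eq_integral_qcdLatticeMeasure]
    exact integral_nonneg fun U => Real.rpow_nonneg (hY0 U) _
  have hinv : s' / s = p⁻¹ := by rw [hp, inv_div]
  calc qcdPhaseQuenchedExpect β S mq (fun U => Y U ^ s')
      = ((qcdPhaseQuenchedExpect β S mq (fun U => Y U ^ s')) ^ p) ^ p⁻¹ := by
        rw [Real.rpow_rpow_inv ha hp0.ne']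
    _ ≤ (qcdPhaseQuenchedExpect β S mq (fun U => Y U ^ s)) ^ p⁻¹ :=
        Real.rpow_le_rpow (Real.rpow_nonneg ha _) hJ (inv_nonneg.2 hp0.le)
    _ = (qcdPhaseQuenchedExpect β S mq (fun U => Y U ^ s)) ^ (s' / s) := by rw [hinv]

/-- **Flavour reduction under the phase-quenched weight**: inside any quantity multiplied by
`|det D(U)|`, the same-flavour block of the `N_f`-flavour propagator `(diracMatrix U mq)⁻¹` may be
replaced by the ONE-flavour propagator `D_W(U, m_f)⁻¹` — where every one-flavour determinant is
non-zero the two blocks agree (`inv_diracMatrix_apply_same_flavour`), and where one of them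
vanishes so does the weight (`det_diracMatrix`), killing both sides.  This is the step "reduce the
multi-flavour moment to the one-flavour Green function" of every single-flavour propagator estimate
carried out under `E_{|w|}` (no invertibility hypothesis survives). [cite: MontvayMunster1994, §5.1 (flavour-diagonal Wilson action)] -/
theorem norm_det_diracMatrix_smul_sameFlavourBlock {E : Type*} [AddCommGroup E] [Module ℝ E]
    (U : GaugeConfig 4 S SU3) (mq : Fin Nf → ℝ) (f : Fin Nf)
    (Φ : Matrix (TorusSite 4 S × Fin 3 × Fin 4) (TorusSite 4 S × Fin 3 × Fin 4) ℂ → E) :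
    ‖(diracMatrix U mq).det‖ •
        Φ (Matrix.of fun p q => (diracMatrix U mq)⁻¹ (quarkEquiv (f, p)) (quarkEquiv (f, q))) =
      ‖(diracMatrix U mq).det‖ • Φ (wilsonDirac (fundamentalRep (Fin 3)) U (mq f) 1)⁻¹ := by
  by_cases h : ∀ g, (wilsonDirac (fundamentalRep (Fin 3)) U (mq g) 1).det ≠ 0
  · congr 1
    congr 1
    ext p q
    rw [Matrix.of_apply, inv_diracMatrix_apply_same_flavour U mq h f p q]
  · push Not at h
    obtain ⟨g, hg⟩ := h
    have h0 : (diracMatrix U mq).det = 0 := by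
      rw [det_diracMatrix]
      exact Finset.prod_eq_zero (Finset.mem_univ g) hg
    rw [h0, norm_zero, zero_smul, zero_smul]

/-- Scalar form of `norm_det_diracMatrix_smul_sameFlavourBlock` for ONE entry: under the weight
`|det D(U)|`, `F(G((f,p),(f,q))) = F(D_W(U,m_f)⁻¹(p,q))` for every `F : ℂ → ℝ`. [folklore] -/
theorem norm_det_diracMatrix_mul_apply_inv_eq (U : GaugeConfig 4 S SU3) (mq : Fin Nf → ℝ) (f : Fin Nf)
    (p q : TorusSite 4 S × Fin 3 × Fin 4) (F : ℂ → ℝ) :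
    ‖(diracMatrix U mq).det‖ * F ((diracMatrix U mq)⁻¹ (quarkEquiv (f, p)) (quarkEquiv (f, q))) =
      ‖(diracMatrix U mq).det‖ * F ((wilsonDirac (fundamentalRep (Fin 3)) U (mq f) 1)⁻¹ p q) := by
  have h := norm_det_diracMatrix_smul_sameFlavourBlock (S := S) U mq f (fun M => F (M p q))
  simpa only [smul_eq_mul, Matrix.of_apply] using h

end Summit.QuantumFields.QCD.Cruxes.FMClosureUnquenched.Toolkit

end
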